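import Summits.KontsevichZagierPeriods.Zeta5Search.Certificates.TwoTaleTelescopeBgR

/-!
# (bmiss)@Ω — cert-2's certificate atoms of direction `bg`, evaluated (cell `pub-zeta5`, cert-1 gen 4)

HONEST FRAMING: systematic search; recurrence certificates; no irrationality claim unless certified. Pure algebra over `ℚ`.

Values of the opaque atoms of `Certificates.TwoTaleTelescope.telescope_bg_L` (variable `t`) and `telescope_bg_R` (at `t = u/2`,
`u` the lattice variable): the Γ-ratio linear-form products and the (`t`-free) certificate numerators `x_L` (`xBgLv`) and `x_R`
(`xBgRv`).
-/

noncomputable section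

open Polynomial
open Summit.KontsevichZagierPeriods.Zeta5Search.Certificates.TwoTaleTelescope

namespace Summit.KontsevichZagierPeriods.Zeta5Search.TwoTaleOmega

/-- Value of cert-2's atom `lprod numBgL1`. -/
theorem numBgL1_eval (a b e f g t : ℚ) : lprod numBgL1 a b e f g t = (b + t) := by
  simp only [lprod_cons, lprod_nil, lval, numBgL1, List.getD_cons_zero, List.getD_cons_succ]
  push_cast; ring

/-- Value of cert-2's atom `lprod numBgL2`. -/
theorem numBgL2_eval (a b e f g t : ℚ) : lprod numBgL2 a b e f g t = (b + t) * (b + t + 1) := by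
  simp only [lprod_cons, lprod_nil, lval, numBgL2, List.getD_cons_zero, List.getD_cons_succ]
  push_cast; ring

/-- Value of cert-2's atom `lprod numBgL3`. -/
theorem numBgL3_eval (a b e f g t : ℚ) : lprod numBgL3 a b e f g t = (b + t) * (b + t + 1) * (b + t + 2) := by
  simp only [lprod_cons, lprod_nil, lval, numBgL3, List.getD_cons_zero, List.getD_cons_succ]
  push_cast; ring

/-- Value of cert-2's atom `lprod denBgL1`. -/
theorem denBgL1_eval (a b e f g t : ℚ) : lprod denBgL1 a b e f g t = (g + t) := by
  simp only [lprod_cons, lprod_nil, lval, denBgL1, List.getD_cons_zero, List.getD_cons_succ]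
  push_cast; ring

/-- Value of cert-2's atom `lprod denBgL2`. -/
theorem denBgL2_eval (a b e f g t : ℚ) : lprod denBgL2 a b e f g t = (g + t) * (g + t + 1) := by
  simp only [lprod_cons, lprod_nil, lval, denBgL2, List.getD_cons_zero, List.getD_cons_succ]
  push_cast; ring

/-- Value of cert-2's atom `lprod denBgL3`. -/
theorem denBgL3_eval (a b e f g t : ℚ) : lprod denBgL3 a b e f g t = (g + t) * (g + t + 1) * (g + t + 2) := by
  simp only [lprod_cons, lprod_nil, lval, denBgL3, List.getD_cons_zero, List.getD_cons_succ]
  push_cast; ring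

/-- Value of cert-2's atom `lprod tnBgL`. -/
theorem tnBgL_eval (a b e f g t : ℚ) : lprod tnBgL a b e f g t = (a + t) * (b + t) * (e + t) * (f + t) := by
  simp only [lprod_cons, lprod_nil, lval, tnBgL, List.getD_cons_zero, List.getD_cons_succ]
  push_cast; ring

/-- Value of cert-2's atom `lprod tdBgL`. -/
theorem tdBgL_eval (a b e f g t : ℚ) : lprod tdBgL a b e f g t = (t + 1) * (a - e + t + 1) * (a - f + t + 1) * (g + t) := by
  simp only [lprod_cons, lprod_nil, lval, tdBgL, List.getD_cons_zero, List.getD_cons_succ]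
  push_cast; ring

/-- Value of cert-2's atom `lprod cnumBgL`. -/
theorem cnumBgL_eval (a b e f g t : ℚ) : lprod cnumBgL a b e f g t = (t) * (a - e + t) * (a - f + t) * (g + t + 2) := by
  simp only [lprod_cons, lprod_nil, lval, cnumBgL, List.getD_cons_zero, List.getD_cons_succ]
  push_cast; ring

/-- Value of cert-2's atom `lprod cnumSBgL`. -/
theorem cnumSBgL_eval (a b e f g t : ℚ) : lprod cnumSBgL a b e f g t = (t + 1) * (a - e + t + 1) * (a - f + t + 1) * (g + t + 3) := by
  simp only [lprod_cons, lprod_nil, lval, cnumSBgL, List.getD_cons_zero, List.getD_cons_succ]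
  push_cast; ring

/-- Value of cert-2's atom `lprod cdenBgL`. -/
theorem cdenBgL_eval (a b e f g t : ℚ) : lprod cdenBgL a b e f g t = (g + t) * (g + t + 1) * (g + t + 2) := by
  simp only [lprod_cons, lprod_nil, lval, cdenBgL, List.getD_cons_zero, List.getD_cons_succ]
  push_cast; ring

/-- Value of cert-2's atom `lprod cdenSBgL`. -/
theorem cdenSBgL_eval (a b e f g t : ℚ) : lprod cdenSBgL a b e f g t = (g + t + 1) * (g + t + 2) * (g + t + 3) := by
  simp only [lprod_cons, lprod_nil, lval, cdenSBgL, List.getD_cons_zero, List.getD_cons_succ]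
  push_cast; ring

/-- Value of cert-2's atom `lprod numBgR1` at `t = u/2`. -/
theorem numBgR1_eval (a b e f g u : ℚ) : lprod numBgR1 a b e f g (u / 2) = (a - b + u / 2) := by
  simp only [lprod_cons, lprod_nil, lval, numBgR1, List.getD_cons_zero, List.getD_cons_succ]
  push_cast; ring

/-- Value of cert-2's atom `lprod numBgR2` at `t = u/2`. -/
theorem numBgR2_eval (a b e f g u : ℚ) : lprod numBgR2 a b e f g (u / 2) = (a - b + u / 2) * (a - b + u / 2 - 1) := by
  simp only [lprod_cons, lprod_nil, lval, numBgR2, List.getD_cons_zero, List.getD_cons_succ]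
  push_cast; ring

/-- Value of cert-2's atom `lprod numBgR3` at `t = u/2`. -/
theorem numBgR3_eval (a b e f g u : ℚ) : lprod numBgR3 a b e f g (u / 2) = (a - b + u / 2) * (a - b + u / 2 - 1) * (a - b + u / 2 - 2) := by
  simp only [lprod_cons, lprod_nil, lval, numBgR3, List.getD_cons_zero, List.getD_cons_succ]
  push_cast; ring

/-- Value of cert-2's atom `lprod denBgR1` at `t = u/2`. -/
theorem denBgR1_eval (a b e f g u : ℚ) : lprod denBgR1 a b e f g (u / 2) = (g + u / 2) := by
  simp only [lprod_cons, lprod_nil, lval, denBgR1, List.getD_cons_zero, List.getD_cons_succ]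
  push_cast; ring

/-- Value of cert-2's atom `lprod denBgR2` at `t = u/2`. -/
theorem denBgR2_eval (a b e f g u : ℚ) : lprod denBgR2 a b e f g (u / 2) = (g + u / 2) * (g + u / 2 + 1) := by
  simp only [lprod_cons, lprod_nil, lval, denBgR2, List.getD_cons_zero, List.getD_cons_succ]
  push_cast; ring

/-- Value of cert-2's atom `lprod denBgR3` at `t = u/2`. -/
theorem denBgR3_eval (a b e f g u : ℚ) : lprod denBgR3 a b e f g (u / 2) = (g + u / 2) * (g + u / 2 + 1) * (g + u / 2 + 2) := by
  simp only [lprod_cons, lprod_nil, lval, denBgR3, List.getD_cons_zero, List.getD_cons_succ]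
  push_cast; ring

/-- Value of cert-2's atom `lprod tnBgR` at `t = u/2`. -/
theorem tnBgR_eval (a b e f g u : ℚ) : lprod tnBgR a b e f g (u / 2) = (a - b + g + u) * (a - b + g + u + 1) * (a + u / 2) * (e + u / 2) * (f + u / 2) := by
  simp only [lprod_cons, lprod_nil, lval, tnBgR, List.getD_cons_zero, List.getD_cons_succ]
  push_cast; ring

/-- Value of cert-2's atom `lprod tdBgR` at `t = u/2`. -/
theorem tdBgR_eval (a b e f g u : ℚ) : lprod tdBgR a b e f g (u / 2) = (a + u + 1) * (a + u + 2) * (a - b + u / 2 + 1) * (e + f + u / 2) * (g + u / 2) := by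
  simp only [lprod_cons, lprod_nil, lval, tdBgR, List.getD_cons_zero, List.getD_cons_succ]
  push_cast; ring

/-- Value of cert-2's atom `lprod cnumBgR` at `t = u/2`. -/
theorem cnumBgR_eval (a b e f g u : ℚ) : lprod cnumBgR a b e f g (u / 2) = (a + u - 1) * (a + u) * (a - b + u / 2) * (e + f + u / 2 - 1) * (g + u / 2 + 2) := by
  simp only [lprod_cons, lprod_nil, lval, cnumBgR, List.getD_cons_zero, List.getD_cons_succ]
  push_cast; ring

/-- Value of cert-2's atom `lprod cnumSBgR` at `t = u/2`. -/
theorem cnumSBgR_eval (a b e f g u : ℚ) : lprod cnumSBgR a b e f g (u / 2) = (a + u + 1) * (a + u + 2) * (a - b + u / 2 + 1) * (e + f + u / 2) * (g + u / 2 + 3) := by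
  simp only [lprod_cons, lprod_nil, lval, cnumSBgR, List.getD_cons_zero, List.getD_cons_succ]
  push_cast; ring

/-- Value of cert-2's atom `lprod cdenBgR` at `t = u/2`. -/
theorem cdenBgR_eval (a b e f g u : ℚ) : lprod cdenBgR a b e f g (u / 2) = (g + u / 2) * (g + u / 2 + 1) * (g + u / 2 + 2) := by
  simp only [lprod_cons, lprod_nil, lval, cdenBgR, List.getD_cons_zero, List.getD_cons_succ]
  push_cast; ring

/-- Value of cert-2's atom `lprod cdenSBgR` at `t = u/2`. -/
theorem cdenSBgR_eval (a b e f g u : ℚ) : lprod cdenSBgR a b e f g (u / 2) = (g + u / 2 + 1) * (g + u / 2 + 2) * (g + u / 2 + 3) := by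
  simp only [lprod_cons, lprod_nil, lval, cdenSBgR, List.getD_cons_zero, List.getD_cons_succ]
  push_cast; ring

/-- The (t-free) side-`L` certificate numerator `x_L(a,b,e,f,g)` of direction `bg`. -/
def xBgLv (a b e f g : ℚ) : ℚ := spvalC (xBgL.getD 0 []) a b e f g

/-- cert-2's atom `polyTN xBgL s` is the constant `x_L`. -/
theorem polyTN_xBgL (s : ℤ) (a b e f g t : ℚ) : polyTN xBgL s a b e f g t = xBgLv a b e f g := by
  have hl : xBgL.length = 1 := rfl
  simp [polyTN, hl, xBgLv]

/-- The (t-free) side-`R` certificate numerator `x_R(a,b,e,f,g)` of direction `bg`. -/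
def xBgRv (a b e f g : ℚ) : ℚ := spvalC (xBgR.getD 0 []) a b e f g

/-- cert-2's atom `polyTN xBgR s` is the constant `x_R`. -/
theorem polyTN_xBgR (s : ℤ) (a b e f g t : ℚ) : polyTN xBgR s a b e f g t = xBgRv a b e f g := by
  have hl : xBgR.length = 1 := rfl
  simp [polyTN, hl, xBgRv]

end Summit.KontsevichZagierPeriods.Zeta5Search.TwoTaleOmega

end
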